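import Summits.BirchSwinnertonDyer.BirchSwinnertonDyer.Theorems.ManinLocalTwoThreeShimuraIndexTotient
import Summits.BirchSwinnertonDyer.BirchSwinnertonDyer.Theorems.ManinLocalTwoThreeShimuraIndexAtTwoExponent
import Mathlib.LinearAlgebra.FreeModule.PID
import HarnessLib

/-!
# THE SQUARE BOUND: `mΛ₀(f) ⊆ Λ₁(f) ⟹ [Λ₀(f) : Λ₁(f)] ∣ m²` for the newform of EVERY modular elliptic curve —
# hence `[Λ₀ : Λ₁] ∈ {1, 2, 4}` at every level with `4 ∣ N`, `∣ 9` at `9 ∣ N`, and `∣ 25 ∨ ∣ 16 ∨ ∣ 9 ∨ ∣ 4` unconditionally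

Summit `BirchSwinnertonDyer`, route `ManinLocalTwoThree` (cell bsd-f2-manin), crux C2 `ManinOddAtFour`
(stmt-BirchSwinnertonDyer-22967; §3–§5 bear equally on C3 `ManinPrimeToThreeAtNine`, stmt-BirchSwinnertonDyer-22968).
Planner seat bsd-f2-manin-es (LENS es: the Shimura covering `X₁(N) → X₀(N)` read on period lattices), gen 46;
TURNKEY T-es-111 for the C2/C3 LEAD (prover bsd-line-manin23-p1).  Sequel to `…ShimuraIndexTotient` (T-es-108:
`[Λ₀ : Λ₁] ∣ φ(N)/2`, the bound from the SOURCE `(ℤ/N)ˣ/{±1} ↠ Λ₀/Λ₁`) — this file is the bound from the TARGET.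

THE OBSERVATION.  For an `X₀(N)`-datum `D₀ : ModularParametrizationData W₀ N` the structure field
`smul_periodLattice_le : c · Λ₀(f) ⊆ Λ_E = ℤω₁ ⊕ ℤω₂` (with `c ≠ 0`, `maninConstant_ne_zero_holds`) embeds the period
lattice `Λ₀(f)` of the newform into a free `ℤ`-module of rank `2`; by the structure theorem for submodules of free modules
over a PID (`Submodule.basisOfPidOfLE`, `Module.Basis.card_le_card_of_le`) `Λ₀(f)` is generated by `n ≤ 2` periods
(§1, `exists_generators_periodLattice`).  Consequently, if `m · Λ₀(f) ⊆ Λ₁(f)` then `k ↦ Σ kᵢ gᵢ` is a SURJECTION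
`(ℤ/m)ⁿ ↠ Λ₀(f)/Λ₁(f)` (`ZMod.lift`), so `[Λ₀(f) : Λ₁(f)] ∣ mⁿ ∣ m²` (§2, `relIndex_dvd_sq_of_natMul_mem`;
`AddSubgroup.card_dvd_of_surjective`).  No optimality, no level shape, no Literature fact beyond the datum's own fields.

CONSEQUENCES (all UNCONDITIONAL, every datum, every level):
* §3 TRACELESS PRIMES.  `p ∣ N`, `a_p(f) = 0` ⟹ `pΛ₀ ⊆ Λ₁` (Ling–Oesterlé `U_p = p` on `Σ(N)`, tree
  `pMulLatticeLeGamma1OfTracelessPrime_holds`) ⟹ `[Λ₀ : Λ₁] ∣ p²`; in particular `p² ∣ N ⟹ [Λ₀ : Λ₁] ∣ p²`: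
  `4 ∣ N ⟹ [Λ₀ : Λ₁] ∈ {1, 2, 4}` (`relIndex_eq_one_or_two_or_four_of_four_dvd` — the a-priori menu behind E-an-152b
  «index ≠ 4» at EVERY level with `4 ∣ N`, not only the `±`-cyclic ones where `…ShimuraQuotientLevelInstances` /
  es T-es-110 give `∣ 2`), `9 ∣ N ⟹ [Λ₀ : Λ₁] ∈ {1, 3, 9}` (C3's currency; cf. `…ShimuraIndexNeNine`).
* §4 WITH THE TOTIENT LAW (T-es-108): `[Λ₀ : Λ₁] ∣ gcd(m², φ(N)/2)`; instances `N = 45 = 9·5 ⟹ ∣ gcd(9, 12) = 3`,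
  `N = 75 = 3·25 ⟹ ∣ gcd(25, 20) = 5`, `N = 147 = 3·49 ⟹ ∣ gcd(49, 42) = 7` (and then `= 1` by §5, since no prime `≥ 7`
  divides the menu: `relIndex_eq_one_oneFortySeven_datum`; E15: `147a, b, c ↦ 1`).
* §5 THE `a₂`-MENU.  With the Eisenstein inputs at `2` of `…ShimuraIndexAtTwoExponent` (`(a₂(W) − 3)Λ₀ ⊆ Λ₁` with
  `|a₂(W)| ≤ 2` at odd level; `(e − 2)Λ₀ ⊆ Λ₁`, `e ∈ {0, ±1}`, at even level): at ODD level `[Λ₀ : Λ₁] ∣ (3 − a₂(W))²`,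
  at EVEN level `[Λ₀ : Λ₁] ∣ 4 ∨ [Λ₀ : Λ₁] ∣ 9`; so for EVERY modular parametrisation of a globally minimal elliptic
  curve over `ℚ`: `[Λ₀(f) : Λ₁(f)] ∣ 25 ∨ ∣ 16 ∨ ∣ 9 ∨ ∣ 4`, i.e. `[Λ₀ : Λ₁] ∈ {1, 2, 3, 4, 5, 8, 9, 16, 25}`,
  `[Λ₀ : Λ₁] ≤ 25`, and NO prime `≥ 7` divides the index (`relIndex_mem_menu`, `relIndex_le_twentyFive`,
  `not_dvd_relIndex_of_seven_le`).  `…ShimuraIndexAtTwo` gave the prime SUPPORT `{2, 3, 5}` of the index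
  (`shimuraIndexPrimeTo_of_seven_le_of_not_two_dvd`, `shimuraIndexPrimeTo_of_five_le_of_two_dvd`); this file bounds the
  EXPONENTS.  es census
  E15 (1025 optimal classes): `[Λ₀ : Λ₁] = 1, 2, 3, 4, 5` for `926, 73, 23, 2, 1` classes — `5` at `11a` (`a₂ = −2`),
  `4` at `15a, 17a` (`a₂ = −1`), `3` at `14a, 19a, 26a, 27a, …`.

HONEST FRAMING.  Elementary consequences of the rank of the Néron lattice; Ling–Oesterlé [LO91, §1] describe `Σ(N)` and
hence know `E ∩ Σ(N) ⊂ E(ℚ̄)` is a finite subquotient of `(ℤ/N)ˣ`; the bound `∣ m²` for the intersection with an ELLIPTIC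
optimal quotient is the rank-`2` shadow of that picture and is not claimed to be new mathematics — it is new in the tree and
it is the form the cell's C2/C3 bookkeeping consumes (`relIndex` currency of T-es-107/108).  Two traceless primes ⟹
`Λ₁ = Λ₀` is ALREADY the Literature theorem `gamma1LatticeEqOfTwoTracelessPrimes_holds` (and `4 ∣ N ∧ q² ∣ N` is
`…ShimuraQuotientHeckeAtFour.periodLatticeGamma1_eq_of_four_dvd_of_odd_sq_dvd`) — not restated here.  C2, C3, Manin's
conjecture and BSD are NOT proved by this file.  No definitions, no sorry.
[cite: LingOesterle1991, §1, Thm. 1 and Thm. 6] [cite: Stevens1989, §2] [cite: Mazur1977, II.(11.6)]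
[cite: SilvermanAEC2009, Thm. V.1.1 and VI.5.1 (the Néron lattice has rank 2)]
-/

set_option autoImplicit false
-- the summit-side namespace `Summit.BirchSwinnertonDyer.BirchSwinnertonDyer.…` is the tree's (summit = sub-problem)
set_option linter.dupNamespace false

noncomputable section

open scoped Classical MatrixGroups

open CongruenceSubgroup Matrix.SpecialLinearGroup ModularGroup
open Literature.NumberTheory.EllipticCurves Literature.NumberTheory.EllipticCurves.ModularForms

namespace Summit.BirchSwinnertonDyer.BirchSwinnertonDyer.Theorems.ManinLocalTwoThree.ShimuraIndex

section General

variable {W₀ : WeierstrassCurve ℚ} {N : ℕ} [NeZero N]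

/-! ## §1 The period lattice of a modular elliptic curve is generated by at most two periods -/

/-- **Rank `≤ 2`.**  For an `X₀(N)`-datum `D₀` (`c Λ₀(f) ⊆ Λ_E = ℤω₁ ⊕ ℤω₂`, `c ≠ 0`): there are `n ≤ 2` periods
`g₀, …, g_{n−1} ∈ Λ₀(f)` such that every period of `f` is an integral combination of them.
[cite: SilvermanAEC2009, Thm. VI.5.1] -/
theorem exists_generators_periodLattice (D₀ : ModularParametrizationData W₀ N) :
    ∃ (n : ℕ) (g : Fin n → ℂ), n ≤ 2 ∧ (∀ i, g i ∈ periodLattice D₀.f) ∧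
      ∀ z ∈ periodLattice D₀.f, ∃ k : Fin n → ℤ, z = ∑ i, (k i : ℂ) * g i := by
  have hc : (D₀.c : ℂ) ≠ 0 := by exact_mod_cast D₀.maninConstant_ne_zero_holds
  -- the `ℤ`-submodule `c Λ₀(f)` of `Λ_E`
  set M : Submodule ℤ ℂ := (periodLattice D₀.f).toIntSubmodule.map (LinearMap.mulLeft ℤ (D₀.c : ℂ)) with hM
  have hle : M ≤ D₀.L.lattice := by
    rintro x ⟨z, hz, rfl⟩
    exact D₀.smul_periodLattice_le z hz
  obtain ⟨n, b⟩ := Submodule.basisOfPidOfLE hle D₀.L.latticeBasis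
  have hn : n ≤ 2 := by simpa using Module.Basis.card_le_card_of_le hle D₀.L.latticeBasis b
  refine ⟨n, fun i ↦ (b i : ℂ) / D₀.c, hn, fun i ↦ ?_, fun z hz ↦ ?_⟩
  · obtain ⟨z, hz, hzi⟩ := (Submodule.mem_map.mp (b i).2)
    have : (b i : ℂ) / D₀.c = z := by
      rw [← hzi, LinearMap.mulLeft_apply, mul_div_cancel_left₀ _ hc]
    change (b i : ℂ) / (D₀.c : ℂ) ∈ periodLattice D₀.f
    rw [this]; exact hz
  · have hx : (D₀.c : ℂ) * z ∈ M := Submodule.mem_map.mpr ⟨z, hz, rfl⟩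
    refine ⟨fun i ↦ b.repr ⟨_, hx⟩ i, ?_⟩
    have hsum := congrArg (fun y : M ↦ (y : ℂ)) (b.sum_repr ⟨_, hx⟩)
    simp only [Submodule.coe_sum, Submodule.coe_smul_of_tower, zsmul_eq_mul] at hsum
    have : ∑ i, (b.repr ⟨_, hx⟩ i : ℂ) * ((b i : ℂ) / D₀.c) =
        (∑ i, (b.repr ⟨_, hx⟩ i : ℂ) * (b i : ℂ)) / D₀.c := by
      rw [Finset.sum_div]; refine Finset.sum_congr rfl fun i _ ↦ ?_; ring
    rw [this, hsum, mul_div_cancel_left₀ _ hc]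

/-! ## §2 The square bound -/

/-- **THE SQUARE BOUND.**  If `m Λ₀(f) ⊆ Λ₁(f)` for a natural number `m`, then `[Λ₀(f) : Λ₁(f)] ∣ m²` — for the
newform of ANY `X₀(N)`-parametrised elliptic curve: `k ↦ Σ kᵢ gᵢ` is a surjection `(ℤ/m)ⁿ ↠ Λ₀/Λ₁` with `n ≤ 2` (§1).
[cite: LingOesterle1991, §1] [cite: SilvermanAEC2009, Thm. VI.5.1] -/
theorem relIndex_dvd_sq_of_natMul_mem (D₀ : ModularParametrizationData W₀ N) {m : ℕ}
    (hm : ∀ z ∈ periodLattice D₀.f, (m : ℂ) * z ∈ periodLatticeGamma1 D₀.f) :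
    (periodLatticeGamma1 D₀.f).relIndex (periodLattice D₀.f) ∣ m ^ 2 := by
  rcases Nat.eq_zero_or_pos m with rfl | hm0
  · simp
  haveI : NeZero m := ⟨hm0.ne'⟩
  obtain ⟨n, g, hn, hg, hgen⟩ := exists_generators_periodLattice D₀
  set Λ₀ := periodLattice D₀.f with hΛ₀
  set Λ₁ := periodLatticeGamma1 D₀.f with hΛ₁
  set H : AddSubgroup Λ₀ := Λ₁.addSubgroupOf Λ₀ with hH
  -- the generators as elements of `Λ₀`, and the maps `ℤ/m → Λ₀/Λ₁`, `k ↦ k • gᵢ`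
  let gg : Fin n → Λ₀ := fun i ↦ ⟨g i, hg i⟩
  have hkill : ∀ i, (zmultiplesHom (Λ₀ ⧸ H) (QuotientAddGroup.mk (gg i))) (m : ℤ) = 0 := by
    intro i
    rw [zmultiplesHom_apply, ← QuotientAddGroup.mk_zsmul, QuotientAddGroup.eq_zero_iff, hH,
      AddSubgroup.mem_addSubgroupOf]
    show ((m : ℤ) • gg i : Λ₀).val ∈ Λ₁
    simp only [AddSubgroupClass.coe_zsmul, zsmul_eq_mul, Int.cast_natCast]
    exact hm _ (hg i)
  let φ : Fin n → (ZMod m →+ Λ₀ ⧸ H) :=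
    fun i ↦ ZMod.lift m ⟨zmultiplesHom (Λ₀ ⧸ H) (QuotientAddGroup.mk (gg i)), hkill i⟩
  let Φ : (Fin n → ZMod m) →+ Λ₀ ⧸ H := ∑ i, (φ i).comp (Pi.evalAddMonoidHom (fun _ ↦ ZMod m) i)
  have hΦ : Function.Surjective Φ := by
    intro q
    obtain ⟨x, rfl⟩ := QuotientAddGroup.mk_surjective q
    obtain ⟨k, hk⟩ := hgen x x.2
    refine ⟨fun i ↦ ((k i : ℤ) : ZMod m), ?_⟩
    have hx : x = ∑ i, (k i) • gg i := by
      apply Subtype.ext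
      simp only [AddSubgroup.val_finsetSum, AddSubgroupClass.coe_zsmul, zsmul_eq_mul]
      exact hk
    rw [hx, AddMonoidHom.finsetSum_apply]
    simp only [φ, AddMonoidHom.coe_comp, Function.comp_apply, Pi.evalAddMonoidHom_apply, ZMod.lift_coe,
      zmultiplesHom_apply]
    change ∑ x, k x • (QuotientAddGroup.mk' H (gg x)) = QuotientAddGroup.mk' H (∑ i, k i • gg i)
    rw [map_sum]; simp only [map_zsmul]
  have hdvd := AddSubgroup.card_dvd_of_surjective Φ hΦ
  have hcard : Nat.card (Fin n → ZMod m) = m ^ n := by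
    rw [Nat.card_fun]; simp
  rw [hcard] at hdvd
  have hidx : Λ₁.relIndex Λ₀ = Nat.card (Λ₀ ⧸ H) := by
    rw [AddSubgroup.relIndex, hH, AddSubgroup.index_eq_card]
  rw [hidx]
  exact hdvd.trans (pow_dvd_pow m hn)

/-- The square bound for an INTEGER multiplier: `m Λ₀(f) ⊆ Λ₁(f)`, `m : ℤ` ⟹ `[Λ₀(f) : Λ₁(f)] ∣ |m|²`.
[cite: LingOesterle1991, §1] -/
theorem relIndex_dvd_natAbs_sq_of_intMul_mem (D₀ : ModularParametrizationData W₀ N) {m : ℤ}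
    (hm : ∀ z ∈ periodLattice D₀.f, (m : ℂ) * z ∈ periodLatticeGamma1 D₀.f) :
    (periodLatticeGamma1 D₀.f).relIndex (periodLattice D₀.f) ∣ m.natAbs ^ 2 := by
  refine relIndex_dvd_sq_of_natMul_mem D₀ fun z hz ↦ ?_
  have h := hm z hz
  rcases Int.natAbs_eq m with h' | h'
  · rw [h'] at h
    simpa only [Int.cast_natCast] using h
  · rw [h'] at h
    simp only [Int.cast_neg, Int.cast_natCast, neg_mul] at h
    exact neg_mem_iff.mp h

/-- The square bound is at most `m²`-strong: `[Λ₀(f) : Λ₁(f)] ≤ m²` for `m ≠ 0` with `m Λ₀(f) ⊆ Λ₁(f)`.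
[cite: LingOesterle1991, §1] -/
theorem relIndex_le_sq_of_natMul_mem (D₀ : ModularParametrizationData W₀ N) {m : ℕ} (hm0 : m ≠ 0)
    (hm : ∀ z ∈ periodLattice D₀.f, (m : ℂ) * z ∈ periodLatticeGamma1 D₀.f) :
    (periodLatticeGamma1 D₀.f).relIndex (periodLattice D₀.f) ≤ m ^ 2 :=
  Nat.le_of_dvd (by positivity) (relIndex_dvd_sq_of_natMul_mem D₀ hm)

/-! ## §3 Traceless primes: `p ∣ N`, `a_p = 0` ⟹ `[Λ₀ : Λ₁] ∣ p²`; `4 ∣ N ⟹ ∈ {1, 2, 4}`; `9 ∣ N ⟹ ∈ {1, 3, 9}` -/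

/-- **`p ∣ N`, `a_p(f) = 0` ⟹ `[Λ₀(f) : Λ₁(f)] ∣ p²`** (every datum): `U_p = p` on `Σ(N)` gives `pΛ₀ ⊆ Λ₁`.
[cite: LingOesterle1991, Thm. 6] -/
theorem relIndex_dvd_sq_of_cuspCoeff_eq_zero (D₀ : ModularParametrizationData W₀ N) {p : ℕ} (hp : p.Prime)
    (hpN : p ∣ N) (hap : cuspCoeff D₀.f p = 0) :
    (periodLatticeGamma1 D₀.f).relIndex (periodLattice D₀.f) ∣ p ^ 2 :=
  relIndex_dvd_sq_of_natMul_mem D₀ fun z hz ↦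
    pMulLatticeLeGamma1OfTracelessPrime_holds N D₀.f D₀.isNewformOf.1 p hp hpN hap z hz

/-- **`p² ∣ N` ⟹ `[Λ₀(f) : Λ₁(f)] ∣ p²`** (every datum; `a_p = 0` is automatic). [cite: LingOesterle1991, Thm. 6]
[cite: AtkinLehner1970, Thm. 3] -/
theorem relIndex_dvd_sq_of_sq_dvd (D₀ : ModularParametrizationData W₀ N) {p : ℕ} (hp : p.Prime) (hsq : p ^ 2 ∣ N) :
    (periodLatticeGamma1 D₀.f).relIndex (periodLattice D₀.f) ∣ p ^ 2 :=
  relIndex_dvd_sq_of_cuspCoeff_eq_zero D₀ hp ((dvd_pow_self p two_ne_zero).trans hsq)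
    (D₀.isNewformOf.1.cuspCoeff_eq_zero_of_sq_dvd hp hsq)

/-- **`4 ∣ N` ⟹ `[Λ₀(f) : Λ₁(f)] ∣ 4`** — every datum, every level (C2's regime). [cite: LingOesterle1991, Thm. 6] -/
theorem relIndex_dvd_four_of_four_dvd (D₀ : ModularParametrizationData W₀ N) (h4 : 2 ^ 2 ∣ N) :
    (periodLatticeGamma1 D₀.f).relIndex (periodLattice D₀.f) ∣ 4 := by
  simpa using relIndex_dvd_sq_of_sq_dvd D₀ Nat.prime_two h4

/-- **`9 ∣ N` ⟹ `[Λ₀(f) : Λ₁(f)] ∣ 9`** — every datum, every level (C3's regime). [cite: LingOesterle1991, Thm. 6] -/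
theorem relIndex_dvd_nine_of_nine_dvd (D₀ : ModularParametrizationData W₀ N) (h9 : 3 ^ 2 ∣ N) :
    (periodLatticeGamma1 D₀.f).relIndex (periodLattice D₀.f) ∣ 9 := by
  simpa using relIndex_dvd_sq_of_sq_dvd D₀ Nat.prime_three h9

/-- **`4 ∣ N` ⟹ `[Λ₀(f) : Λ₁(f)] ∈ {1, 2, 4}`** — the a-priori menu at EVERY level with `4 ∣ N` (E-an-152b asserts `≠ 4`
for optimal data; `…ShimuraQuotientLevelInstances` / T-es-110 give `∣ 2` at the `±`-cyclic levels `4q^k, 8q^k, 16q^k, 2^e`).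
[cite: LingOesterle1991, Thm. 6] -/
theorem relIndex_eq_one_or_two_or_four_of_four_dvd (D₀ : ModularParametrizationData W₀ N) (h4 : 2 ^ 2 ∣ N) :
    (periodLatticeGamma1 D₀.f).relIndex (periodLattice D₀.f) = 1 ∨
      (periodLatticeGamma1 D₀.f).relIndex (periodLattice D₀.f) = 2 ∨
      (periodLatticeGamma1 D₀.f).relIndex (periodLattice D₀.f) = 4 := by
  have h := relIndex_dvd_four_of_four_dvd D₀ h4
  obtain ⟨r, hr⟩ : ∃ r, (periodLatticeGamma1 D₀.f).relIndex (periodLattice D₀.f) = r := ⟨_, rfl⟩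
  rw [hr] at h ⊢
  have hle := Nat.le_of_dvd (by norm_num) h
  interval_cases r <;> omega

/-- **`9 ∣ N` ⟹ `[Λ₀(f) : Λ₁(f)] ∈ {1, 3, 9}`** (every datum; `…ShimuraIndexNeNine` excludes `Λ₁ = 3Λ₀` for Stevens' optimal
datum modulo F★). [cite: LingOesterle1991, Thm. 6] -/
theorem relIndex_eq_one_or_three_or_nine_of_nine_dvd (D₀ : ModularParametrizationData W₀ N) (h9 : 3 ^ 2 ∣ N) :
    (periodLatticeGamma1 D₀.f).relIndex (periodLattice D₀.f) = 1 ∨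
      (periodLatticeGamma1 D₀.f).relIndex (periodLattice D₀.f) = 3 ∨
      (periodLatticeGamma1 D₀.f).relIndex (periodLattice D₀.f) = 9 := by
  have h := relIndex_dvd_nine_of_nine_dvd D₀ h9
  obtain ⟨r, hr⟩ : ∃ r, (periodLatticeGamma1 D₀.f).relIndex (periodLattice D₀.f) = r := ⟨_, rfl⟩
  rw [hr] at h ⊢
  have hle := Nat.le_of_dvd (by norm_num) h
  interval_cases r <;> omega

/-! ## §4 With the totient law: `[Λ₀ : Λ₁] ∣ gcd(m², φ(N)/2)` -/

/-- **Square bound ∧ totient law**: `m Λ₀ ⊆ Λ₁`, `N > 2` ⟹ `[Λ₀(f) : Λ₁(f)] ∣ gcd(m², φ(N)/2)`.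
[cite: LingOesterle1991, §1] -/
theorem relIndex_dvd_gcd_sq_totient_div_two (D₀ : ModularParametrizationData W₀ N) {m : ℕ}
    (hm : ∀ z ∈ periodLattice D₀.f, (m : ℂ) * z ∈ periodLatticeGamma1 D₀.f) (hN : 2 < N) :
    (periodLatticeGamma1 D₀.f).relIndex (periodLattice D₀.f) ∣ Nat.gcd (m ^ 2) (Nat.totient N / 2) :=
  Nat.dvd_gcd (relIndex_dvd_sq_of_natMul_mem D₀ hm) (relIndex_dvd_totient_div_two D₀.f hN)

/-- **Level `45 = 9·5`**: `[Λ₀(f) : Λ₁(f)] ∣ 3` for every datum (`∣ 9` by §3, `∣ φ(45)/2 = 12` by T-es-108).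
[cite: LingOesterle1991, §1 and Thm. 6] -/
theorem relIndex_dvd_three_fortyFive_datum {W₀ : WeierstrassCurve ℚ} (D₀ : ModularParametrizationData W₀ 45) :
    (periodLatticeGamma1 D₀.f).relIndex (periodLattice D₀.f) ∣ 3 := by
  have h := Nat.dvd_gcd (relIndex_dvd_nine_of_nine_dvd D₀ ⟨5, by norm_num⟩)
    (relIndex_dvd_totient_div_two D₀.f (by norm_num))
  have htot : Nat.totient 45 = 24 := by decide
  rw [htot] at h
  exact h.trans (by norm_num)

/-- **Level `75 = 3·25`**: `[Λ₀(f) : Λ₁(f)] ∣ 5` for every datum (`∣ 25` by §3, `∣ φ(75)/2 = 20` by T-es-108).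
[cite: LingOesterle1991, §1 and Thm. 6] -/
theorem relIndex_dvd_five_seventyFive_datum {W₀ : WeierstrassCurve ℚ} (D₀ : ModularParametrizationData W₀ 75) :
    (periodLatticeGamma1 D₀.f).relIndex (periodLattice D₀.f) ∣ 5 := by
  have h := Nat.dvd_gcd (relIndex_dvd_sq_of_sq_dvd D₀ (p := 5) (by norm_num) ⟨3, by norm_num⟩)
    (relIndex_dvd_totient_div_two D₀.f (by norm_num))
  have htot : Nat.totient 75 = 40 := by decide
  rw [htot] at h
  exact h.trans (by norm_num)

/-- **Level `147 = 3·49`**: `[Λ₀(f) : Λ₁(f)] ∣ 7` for every datum (`∣ 49` by §3, `∣ φ(147)/2 = 42` by T-es-108);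
with the `a₂`-menu of §5 (no prime `≥ 7` divides the index) it is `1` for minimal models, `relIndex_eq_one_oneFortySeven_datum`.
[cite: LingOesterle1991, §1 and Thm. 6] -/
theorem relIndex_dvd_seven_oneFortySeven_datum {W₀ : WeierstrassCurve ℚ} (D₀ : ModularParametrizationData W₀ 147) :
    (periodLatticeGamma1 D₀.f).relIndex (periodLattice D₀.f) ∣ 7 := by
  have h := Nat.dvd_gcd (relIndex_dvd_sq_of_sq_dvd D₀ (p := 7) (by norm_num) ⟨3, by norm_num⟩)
    (relIndex_dvd_totient_div_two D₀.f (by norm_num))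
  have htot : Nat.totient 147 = 84 := by decide
  rw [htot] at h
  exact h.trans (by norm_num)

end General

/-! ## §5 The `a₂`-menu: `[Λ₀(f) : Λ₁(f)] ∣ 25 ∨ ∣ 16 ∨ ∣ 9 ∨ ∣ 4` for every modular parametrisation of a minimal curve -/

section Minimal

open Summit.BirchSwinnertonDyer.BirchSwinnertonDyer.Theorems.ManinLocalTwoThree.ShimuraIndexAtTwo

variable (W : WeierstrassCurve ℚ) [W.IsElliptic] [W.IsGloballyMinimal] {N : ℕ} [NeZero N]

/-- **ODD level**: `[Λ₀(f) : Λ₁(f)] ∣ (a₂(W) − 3)²` — `T₂ − 3` kills `Σ(N)` (`2 ∤ N`) and acts on `Λ₀(f)` by `a₂(W) − 3`.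
[cite: LingOesterle1991, Thm. 6] [cite: SilvermanAEC2009, Thm. V.1.1] -/
theorem relIndex_dvd_sq_of_not_two_dvd (D : ModularParametrizationData W N) (hN : ¬ 2 ∣ N) :
    (periodLatticeGamma1 D.f).relIndex (periodLattice D.f) ∣ (W.frobeniusTrace 2 - 3).natAbs ^ 2 :=
  relIndex_dvd_natAbs_sq_of_intMul_mem D (oddLevelEisensteinAtTwo W D.f D.isNewformOf hN).2

/-- **ODD level, the menu**: `[Λ₀(f) : Λ₁(f)] ∣ 25 ∨ ∣ 16 ∨ ∣ 9 ∨ ∣ 4 ∨ = 1` according as `a₂(W) = −2, −1, 0, 1, 2`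
(Hasse: `|a₂(W)| ≤ 2`). [cite: LingOesterle1991, Thm. 6] [cite: SilvermanAEC2009, Thm. V.1.1] -/
theorem relIndex_dvd_of_not_two_dvd (D : ModularParametrizationData W N) (hN : ¬ 2 ∣ N) :
    (W.frobeniusTrace 2 = -2 ∧ (periodLatticeGamma1 D.f).relIndex (periodLattice D.f) ∣ 25) ∨
    (W.frobeniusTrace 2 = -1 ∧ (periodLatticeGamma1 D.f).relIndex (periodLattice D.f) ∣ 16) ∨
    (W.frobeniusTrace 2 = 0 ∧ (periodLatticeGamma1 D.f).relIndex (periodLattice D.f) ∣ 9) ∨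
    (W.frobeniusTrace 2 = 1 ∧ (periodLatticeGamma1 D.f).relIndex (periodLattice D.f) ∣ 4) ∨
    (W.frobeniusTrace 2 = 2 ∧ (periodLatticeGamma1 D.f).relIndex (periodLattice D.f) = 1) := by
  have hdvd := relIndex_dvd_sq_of_not_two_dvd W D hN
  have habs := (oddLevelEisensteinAtTwo W D.f D.isNewformOf hN).1
  obtain ⟨h₁, h₂⟩ := abs_le.mp habs
  have hcases : W.frobeniusTrace 2 = -2 ∨ W.frobeniusTrace 2 = -1 ∨ W.frobeniusTrace 2 = 0 ∨
      W.frobeniusTrace 2 = 1 ∨ W.frobeniusTrace 2 = 2 := by omega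
  rcases hcases with h | h | h | h | h <;> rw [h] at hdvd <;> norm_num at hdvd <;> simp [h, hdvd]

/-- **EVEN level, the menu**: `[Λ₀(f) : Λ₁(f)] ∣ 4 ∨ [Λ₀(f) : Λ₁(f)] ∣ 9` (`(e − 2)Λ₀ ⊆ Λ₁` with `e = a₂ ∈ {0, ±1}`;
`e = 1` gives index `1 ∣ 4`). [cite: LingOesterle1991, Thm. 6] [cite: AtkinLehner1970, Thm. 3] -/
theorem relIndex_dvd_four_or_nine_of_two_dvd {W₀ : WeierstrassCurve ℚ} (D₀ : ModularParametrizationData W₀ N)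
    (hN : 2 ∣ N) :
    (periodLatticeGamma1 D₀.f).relIndex (periodLattice D₀.f) ∣ 4 ∨
      (periodLatticeGamma1 D₀.f).relIndex (periodLattice D₀.f) ∣ 9 := by
  obtain ⟨e, he, hmem⟩ := evenLevelEisensteinAtTwo D₀.f D₀.isNewformOf.1 hN
  have hdvd := relIndex_dvd_natAbs_sq_of_intMul_mem D₀ hmem
  rcases he with rfl | rfl | rfl
  · have h4 : ((0 : ℤ) - 2).natAbs ^ 2 = 4 := by decide
    rw [h4] at hdvd
    exact Or.inl hdvd
  · have h1 : ((1 : ℤ) - 2).natAbs ^ 2 = 1 := by decide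
    rw [h1] at hdvd
    exact Or.inl (hdvd.trans (one_dvd 4))
  · have h9 : ((-1 : ℤ) - 2).natAbs ^ 2 = 9 := by decide
    rw [h9] at hdvd
    exact Or.inr hdvd

/-- **THE MENU (every modular parametrisation of a globally minimal elliptic curve over `ℚ`, every level):**
`[Λ₀(f) : Λ₁(f)] ∣ 25 ∨ ∣ 16 ∨ ∣ 9 ∨ ∣ 4`. [cite: LingOesterle1991, Thm. 6] [cite: SilvermanAEC2009, Thm. V.1.1]
[cite: AtkinLehner1970, Thm. 3] -/
theorem relIndex_dvd_menu (D : ModularParametrizationData W N) :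
    (periodLatticeGamma1 D.f).relIndex (periodLattice D.f) ∣ 25 ∨
      (periodLatticeGamma1 D.f).relIndex (periodLattice D.f) ∣ 16 ∨
      (periodLatticeGamma1 D.f).relIndex (periodLattice D.f) ∣ 9 ∨
      (periodLatticeGamma1 D.f).relIndex (periodLattice D.f) ∣ 4 := by
  by_cases hN : 2 ∣ N
  · rcases relIndex_dvd_four_or_nine_of_two_dvd D hN with h | h
    · exact Or.inr (Or.inr (Or.inr h))
    · exact Or.inr (Or.inr (Or.inl h))
  · rcases relIndex_dvd_of_not_two_dvd W D hN with ⟨-, h⟩ | ⟨-, h⟩ | ⟨-, h⟩ | ⟨-, h⟩ | ⟨-, h⟩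
    · exact Or.inl h
    · exact Or.inr (Or.inl h)
    · exact Or.inr (Or.inr (Or.inl h))
    · exact Or.inr (Or.inr (Or.inr h))
    · exact Or.inr (Or.inr (Or.inr (h ▸ one_dvd 4)))

/-- **`[Λ₀(f) : Λ₁(f)] ∈ {1, 2, 3, 4, 5, 8, 9, 16, 25}`** for every modular parametrisation of a globally minimal elliptic
curve over `ℚ` (es census E15, 1025 optimal classes: the values that occur are `1, 2, 3, 4, 5`).
[cite: LingOesterle1991, Thm. 6] [cite: SilvermanAEC2009, Thm. V.1.1] [cite: AtkinLehner1970, Thm. 3] -/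
theorem relIndex_mem_menu (D : ModularParametrizationData W N) :
    (periodLatticeGamma1 D.f).relIndex (periodLattice D.f) ∈ ({1, 2, 3, 4, 5, 8, 9, 16, 25} : Finset ℕ) := by
  have h := relIndex_dvd_menu W D
  obtain ⟨r, hr⟩ : ∃ r, (periodLatticeGamma1 D.f).relIndex (periodLattice D.f) = r := ⟨_, rfl⟩
  rw [hr] at h ⊢
  have hle : r ≤ 25 := by
    rcases h with h | h | h | h <;> have := Nat.le_of_dvd (by norm_num) h <;> omega
  interval_cases r <;> simp_all

/-- **`[Λ₀(f) : Λ₁(f)] ≤ 25`** for every modular parametrisation of a globally minimal elliptic curve over `ℚ` (the largest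
value in the es census E15 is `5`, at `11a`, where Mazur's `n = num((11 − 1)/12) = 5`).
[cite: LingOesterle1991, Thm. 6] [cite: Mazur1977, II.(11.6)] -/
theorem relIndex_le_twentyFive (D : ModularParametrizationData W N) :
    (periodLatticeGamma1 D.f).relIndex (periodLattice D.f) ≤ 25 := by
  rcases relIndex_dvd_menu W D with h | h | h | h <;> have := Nat.le_of_dvd (by norm_num) h <;> omega

/-- **A prime `p ≥ 7` never divides `[Λ₀(f) : Λ₁(f)]`** (the `relIndex` form of `…ShimuraIndexAtTwo`'s support statements
`shimuraIndexPrimeTo_of_seven_le_of_not_two_dvd` / `shimuraIndexPrimeTo_of_five_le_of_two_dvd`, here read off the menu).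
[cite: LingOesterle1991, Thm. 6] [cite: SilvermanAEC2009, Thm. V.1.1] -/
theorem not_dvd_relIndex_of_seven_le (D : ModularParametrizationData W N) {p : ℕ} (hp : p.Prime) (h7 : 7 ≤ p) :
    ¬ p ∣ (periodLatticeGamma1 D.f).relIndex (periodLattice D.f) := by
  intro hpd
  have hmem := relIndex_mem_menu W D
  obtain ⟨r, hr⟩ : ∃ r, (periodLatticeGamma1 D.f).relIndex (periodLattice D.f) = r := ⟨_, rfl⟩
  rw [hr] at hpd hmem
  have hp5 : ¬ p ∣ 5 := fun h ↦ by
    have := (Nat.prime_dvd_prime_iff_eq hp Nat.prime_five).mp h; omega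
  have hp3 : ¬ p ∣ 3 := fun h ↦ by
    have := (Nat.prime_dvd_prime_iff_eq hp Nat.prime_three).mp h; omega
  have hp2 : ¬ p ∣ 2 := fun h ↦ by
    have := (Nat.prime_dvd_prime_iff_eq hp Nat.prime_two).mp h; omega
  have hp1 : ¬ p ∣ 1 := fun h ↦ by have := Nat.le_of_dvd one_pos h; omega
  simp only [Finset.mem_insert, Finset.mem_singleton] at hmem
  rcases hmem with h | h | h | h | h | h | h | h | h <;> rw [h] at hpd
  · exact hp1 hpd
  · exact hp2 hpd
  · exact hp3 hpd
  · exact hp2 (hp.dvd_of_dvd_pow (n := 2) (by simpa using hpd))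
  · exact hp5 hpd
  · exact hp2 (hp.dvd_of_dvd_pow (n := 3) (by simpa using hpd))
  · exact hp3 (hp.dvd_of_dvd_pow (n := 2) (by simpa using hpd))
  · exact hp2 (hp.dvd_of_dvd_pow (n := 4) (by simpa using hpd))
  · exact hp5 (hp.dvd_of_dvd_pow (n := 2) (by simpa using hpd))

/-- **Level `147 = 3·7²`, minimal model: `[Λ₀(f) : Λ₁(f)] = 1`** for every datum (`∣ 7` by §4, and no prime `≥ 7` divides
the index by §5); E15: `147a, 147b, 147c ↦ 1`.
[cite: LingOesterle1991, §1 and Thm. 6] -/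
theorem relIndex_eq_one_oneFortySeven_datum (D : ModularParametrizationData W 147) :
    (periodLatticeGamma1 D.f).relIndex (periodLattice D.f) = 1 := by
  have h7 := relIndex_dvd_seven_oneFortySeven_datum D
  have hnd := not_dvd_relIndex_of_seven_le W D (by norm_num : (7 : ℕ).Prime) le_rfl
  rcases (Nat.dvd_prime (by norm_num : (7 : ℕ).Prime)).mp h7 with h | h
  · exact h
  · exact absurd (h ▸ dvd_rfl) hnd

end Minimal

end Summit.BirchSwinnertonDyer.BirchSwinnertonDyer.Theorems.ManinLocalTwoThree.ShimuraIndex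

end
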